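import Literature.MathematicalPhysics.QuantumFieldTheory.Balaban1983to89.B8Prop6Reg335ZdLawMember

/-!
# `Balaban1983to89.B8Prop6Reg335ZdDomainSeq` — [Balaban1985RegularSpaces] PROPOSITION 6's PRINTED APPLICATION AT THE FRAME OF RECORD FOR EVERY
# (1.3)–(1.4) MEMBER, `Ω₀` ARBITRARY: for every `ℤᵈ` datum `i` with the domain laws `B8ConstraintBonds.DomainSeq L i.Ω`, every `M ≥ 11d + 1` and every
# truncation `m`, dag-n06-b's junction binder `Prop6At (bgZd 𝔸 L) L memZd (ιCfgZd 𝔸 L) c35 c₆ K₆ M i m` («(3.35) for U₀ by Proposition 6») HOLDS —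
# unconditional for `d ≥ 2`, odd `L ≥ 5`; the hypothesis `i.Ω 0 = univ` of `B8Prop6Reg335ZdLawMember` is REMOVED, so the cube members of the tree
# (`i.Ω = cubeFam _ L a M₀ ρ k`, print's family (1.131), finite `Ω₀ = □₀` included) are covered

statement-level skeleton of published theorems with citation tags; proofs where landed; nothing here is a claim about the
Yang–Mills mass gap

PDF held: `paper:balaban1985-cmp99-regular-spaces-gauge-fixing` p. 77 (p0003: (1.3)–(1.4); (1.7) «|U(∂p) − 1| < α₀L^{−2j} for p ∈ Ω_j» with the touching
convention «we denote by Ω also the set of bonds ⋃_{x∈Ω} st(x) … Similarly for the corresponding set of plaquettes»), p. 98–99 (p0024–p0025: «Now let us take a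
cube □ ⊂ Ω₀ for which we want to prove the condition (3.35) … we can drop out the domains Ω_{j′}, j′ > j, from our assumptions, and change a scale»; Proposition 6;
«hence … we have proved the regularity condition (3.35). This implies that we can drop out this condition from the assumption (1.33)»); [4] =
[Balaban1985BackgroundPropagators] p. 396 (the cube class; (3.35)).  Read on the held text layer by this seat (2026-08-28).

WHY THIS FILE (cell `pub-ymgap`, YM-PLAN Track A node N05, FAN-OUT §N05 row s3b; seat `pub-ymgap-dag-n05-e` (g16); count-neutral).  `B8Prop6Reg335ZdLawMember`
(p613858) proved the binder at the members with `Ω₀ = ℤᵈ`, using `Ω₀ = ℤᵈ` at exactly two places: (i) the class cubes of LOW index `j ≤ s` were served by the axial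
gauge of `B8Prop6Reg335Cube.reg335Cube_index_zero`, whose plaquette hypothesis is GLOBAL (the level-0 clause of (1.7) when `Ω₀ = ℤᵈ`); (ii) the auxiliary
lawful datum fed to Proposition 6 took `Λs ≡ all level-0 sites`, lawful only when `Ω₀ = ℤᵈ`.  Neither is essential: (i) the axial gauge on a box reads only the
plaquettes INSIDE the box — the clamped extension `B7Prop1Local.clampCfg` of `U₀↾□` has ALL its plaquettes α-close to 1 as soon as those inside `□` are
(`norm_hol_plaqWord_clampCfg_le`), the index-0 lemma applies to it verbatim, and a one-layer re-definition of the gauge outside `□` (§1, «boundary surgery»)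
carries the (3.35)-clause back to `U₀`; the plaquettes inside a class cube `□ ⊆ Ω_j ⊆ Ω₀` touch `Ω₀`, so only the level-0 clause of `U₀ ∈ 𝔄_m({Ω_j}, α₀)` is read;
(ii) the datum `⟨i.η, m, i.Ω, Λs ≡ level-0 sites OF Ω₀, Λb ≡ ∅⟩` is lawful for every `Ω`.  The HIGH-index cubes are served as in p613858 (print cube of index `j − s`,
collar inside `Ω_{j−1}` by ONE `DomainSeq.sep`).  CONSUMER: dag-n06-b's cube-member supplier for the genuine record (`B9Thm311InvAtHIWitnessCubeZd` §3, «GIVEN ONLY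
hdict, hP6, h33U») displays `hP6 : Prop6At bg L mem ιCfg …` at the `cubeLamBP` cube member; at `bg := bgZd` this file discharges it (`cubeFam_domainSeq`).  This
seat's located note «cube members: the cube tower is too tight for a second Prop-6 construction» (p613858 ∕ p611683 HONEST SCOPE) is thereby WITHDRAWN.

WHAT IS PROVED (kernel-checked; 0 sorry; 0 def; `𝔸 : Type` a nontrivial C⋆-algebra for §3–§4).
* §1 `reg335Cube_of_eqOn_box` — BOUNDARY SURGERY [folklore]: a (3.35)-clause on a box `□ = boxZd c₀ N` for `V′` transfers to every `V` agreeing with `V′` on the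
  bonds with both ends in `□` — same `A`, same constants (the gauge is re-defined at the sites `z + e_κ ∉ □`, `z ∈ □`, each the end of exactly ONE bond leaving `□`).
* §2 `reg335Cube_lowIndex_local` — the (3.35)-clause at scale `Lʲη`, constant `C·L^{2j}`, on a box `□` of `ℓ¹`-radius `≤ D`, for a `U1`-valued `V` whose
  plaquettes WITH ALL CORNERS IN `□` are α-close to 1, `(D + 1)α ≤ ½`, `C > 4(D + 1)α` — `reg335Cube_lowIndex_of_plaq` ∘ `clampCfg` ∘ §1.
* §3 ★★ `prop6At_bgZd_of_prop6Printed` — p613858 §3 with `i.Ω 0 = univ` REMOVED: `DomainSeq L i.Ω`, `M ≥ 11d + 1`, any `m` ⊢ `Prop6At (bgZd 𝔸 L) L memZd (ιCfgZd 𝔸 L)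
  c35 c₆ 1 M i m`, SAME constants `c35 := (7dL²B₁(20L^s + 2ρ₀) + 84dL^s + 1)·L^{2s}`, `c₆ := min (1∕(42dL^s)) (c₁∕(7dL²(20L^s + 2ρ₀)))`; `exists_…`.
* §4 ★★★ `prop6At_bgZd_domainSeq_holds` (`d ≥ 2`, `L ≥ 5` odd; UNCONDITIONAL ∃-form via `prop6Printed_zdCubP_γ_holds`), `prop6At_binder_domainSeq_holds` (binder shape
  `∀ M i m, P i → DomainSeq L i.Ω → M₃ ≤ M → Prop6At …`, `M₃ = 11d + 1`), ★ `prop6At_bgZd_cubeFam_holds` (every datum with `i.Ω = cubeFam top L a M₀ ρ k`, `L ≤ ρ`,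
  both flags: print's `Ω₀ = T` family and the finite `Ω₀ = □₀` one).
HONEST SCOPE.  (a) Members with `DomainSeq`, ANY `Ω₀`; `M ≥ 11d + 1`; `Λs ∕ Λb` of the datum not read.  (b) Constants explicit, astronomically non-optimal, functions
of `d, L` (and F1's `ρ₀, B₁, c₁`) only; monotone in `c35` (`prop6At_bgZd_mono`).  (c) NOTHING of [4] touched; (3.36) not produced; Proposition 6 CONSUMED by name.
(d) NOT the (false) bridge «(3.35) at the member ⟹ small plaquettes on `□₀ ± 3`» (dag-n06-b LOCATED-SELF-6 ∕ this seat LOCATED-N1-COVERAGE): that one reads `U₀`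
OUTSIDE `Ω₀`; the implication proved here never leaves `Ω₀`.  (e) p613858 ∕ p611683 stand.  Count-neutral; N05 ∕ N06 NOT discharged; one finite lattice programme
at fixed spacing, Bałaban AS PRINTED; nothing continuum ∕ ℝ⁴ ∕ OS ∕ mass-gap ∕ Clay.  No `sorry`, no `axiom`, no definition, no `instance`, no `notation`.
Unit `pub-ymgap-dag-n05-e` (g16), 2026-08-28.
-/

noncomputable section

open NormedSpace

namespace Literature.MathematicalPhysics.QuantumFieldTheory.Balaban1983to89.B8Prop6Reg335ZdDomainSeq

open B7Prop1Explicit B7Prop2Explicit B7Prop1Local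
open B8Ineq130 (tlo thi tlo_zero thi_zero)
open B8Ineq132 (InAk CondAt plaqF PlaqTouches)
open B8LeafModelZd (ZdIdx)
open B8Eq131Cubes (box)
open B8Eq131CubesAdmissible (cubeFam cubeFam_domainSeq)
open B8Eq133Hypotheses (Reg335Zd shiftT byDir byDir_apply shiftT_apply)
open B9Eq335RegularityClasses (Reg335Cube Reg335)
open B9Eq3117Current (gaugeTr)
open B9Eq39Adjoint (fluct)
open B8ConstraintBonds (DomainSeq)
open LatticeNorms (scaleLen scaleLen_pos)
open B9SupplySockB9P3ZdAt (Prop6At)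
open B9SupplySockB9P3ZdFrame (MemberZd memZd bgZd ιCfgZd cubeClass396Zd IsCube396Zd boxZd bigSideZd OmTrunc reg335_bgZd_iff)
open B8Prop6Reg335Cube (reg335Cube_of_gaugedBoundB8)
open B8Prop6Reg335ZdAllTorus (l1_le_of_mem_boxZd prop6At_bgZd_mono)
open B8Prop6Reg335ZdLawMember (reg335Cube_mono reg335Cube_rescale reg335Cube_lowIndex_of_plaq exists_printCube_over_classCube_of_sep)
open B8Prop6PrintedZdCubPGamma (prop6Printed_zdCubP_γ_holds)
open Node00 (CubeB8 GaugedBoundB8 zdCubP prop6Printed_zdCubP_iff)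

variable {d : ℕ}

/-! ## §1 Boundary surgery: a (3.35)-clause on a box depends on the configuration only through the bonds inside the box -/

section Surgery

variable {𝔸 : Type*} [NormedRing 𝔸] [NormedAlgebra ℂ 𝔸] [CompleteSpace 𝔸]

/-- a site one step outside a box in direction `κ` from a site of the box is reached from the box in direction `κ` ONLY (bookkeeping for the surgery). [folklore] -/
private theorem box_exit_unique {c₀ : B7Prop1Explicit.Site d} {N : ℕ} {z : B7Prop1Explicit.Site d} (hz : z ∈ boxZd c₀ N) {κ κ' : Fin d}
    (hzκ : z + e κ ∉ boxZd c₀ N) (h' : z + e κ - e κ' ∈ boxZd c₀ N) : κ' = κ := by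
  by_contra hne
  have hκ := (h' κ)
  have hzκ' : ¬ (c₀ κ ≤ (z + e κ) κ ∧ (z + e κ) κ < c₀ κ + N) := by
    intro hh
    apply hzκ
    intro μ
    by_cases hμ : μ = κ
    · subst hμ; exact hh
    · have : (z + e κ) μ = z μ := by rw [add_e_apply, if_neg hμ, add_zero]
      rw [this]; exact hz μ
  have e1 : (z + e κ - e κ') κ = z κ + 1 := by
    have hne' : ¬ κ = κ' := fun h => hne h.symm
    simp only [Pi.sub_apply, add_e_apply, if_true, e_apply, if_neg hne', sub_zero]
  rw [e1] at hκ
  rw [add_e_apply, if_pos rfl] at hzκ'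
  exact hzκ' hκ

/-- **BOUNDARY SURGERY** [folklore]: a (3.35)-clause `Reg335Cube (shiftT d) (byDir V′) η □ ξ C` on a box `□ = boxZd c₀ N` holds for every `V` agreeing with `V′` on
the bonds with both ends in `□`: keep the gauge `u` on `□` and put `u(z + e_κ) := (e^{iηA_κ(z)})⁻¹·u(z)·V(z, z + e_κ)` at each site `z + e_κ ∉ □`, `z ∈ □` (the end
of exactly one bond leaving `□`), so that `V^u = e^{iηA}` on st(□); `A` and both bounds unchanged. [cite: Balaban1985BackgroundPropagators, (3.35) p.396, (3.28) p.395] -/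
theorem reg335Cube_of_eqOn_box {c₀ : B7Prop1Explicit.Site d} {N : ℕ} {V V' : B7Prop1Explicit.Site d → Fin d → 𝔸ˣ}
    (hagree : ∀ z ∈ boxZd c₀ N, ∀ κ : Fin d, z + e κ ∈ boxZd c₀ N → V z κ = V' z κ) {η ξ C : ℝ}
    (h : Reg335Cube (shiftT d) (byDir V') η (boxZd c₀ N) ξ C) :
    Reg335Cube (shiftT d) (byDir V) η (boxZd c₀ N) ξ C := by
  classical
  obtain ⟨u, A, hu, hrep, hA, hD⟩ := h
  set Q := boxZd c₀ N with hQdef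
  -- the re-defined gauge: `u` on `□`, the surgery value one step outside
  let u' : B7Prop1Explicit.Site d → 𝔸ˣ := fun w =>
    if w ∈ Q then u w
    else if hw : ∃ κ : Fin d, w - e κ ∈ Q then
      (fluct η A hw.choose (w - e hw.choose))⁻¹ * u (w - e hw.choose) * V (w - e hw.choose) hw.choose
    else 1
  have hu'Q : ∀ w ∈ Q, u' w = u w := fun w hw => by simp only [u', if_pos hw]
  refine ⟨u', A, fun z hz => by rw [hu'Q z hz]; exact hu z hz, ?_, hA, hD⟩
  intro κ z hz
  by_cases hzκ : z + e κ ∈ Q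
  · -- an interior bond: `V = V′` there and both gauge values are `u`'s
    have h1 := hrep κ z hz
    simp only [gaugeTr, byDir_apply, shiftT_apply] at h1 ⊢
    rw [hu'Q z hz, hu'Q _ hzκ, hagree z hz κ hzκ]
    exact h1
  · -- a bond leaving `□`: the surgery value
    have hex : ∃ κ' : Fin d, z + e κ - e κ' ∈ Q := ⟨κ, by rw [add_sub_cancel_right]; exact hz⟩
    have hout : u' (z + e κ) = (fluct η A κ z)⁻¹ * u z * V z κ := by
      have hκ' : hex.choose = κ := box_exit_unique hz hzκ hex.choose_spec
      simp only [u', if_neg hzκ, dif_pos hex]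
      rw [hκ', add_sub_cancel_right]
    simp only [gaugeTr, byDir_apply, shiftT_apply]
    rw [hu'Q z hz, hout]
    group

end Surgery

/-! ## §2 The (3.35)-clause at a cube of low index from the plaquettes INSIDE the cube -/

section LowIndex

variable {𝔸 : Type*} [NormedRing 𝔸] [NormedAlgebra ℂ 𝔸] [CompleteSpace 𝔸] [NormOneClass 𝔸]

/-- **(3.35) AT A CUBE OF LOW INDEX `j` FROM THE PLAQUETTES INSIDE THE CUBE** (local form of `B8Prop6Reg335ZdLawMember.reg335Cube_lowIndex_of_plaq`): a `U1`-valued `V`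
whose plaquettes with all four corners in `□ = boxZd c₀ N` are within `α` of `1`, `□` of `ℓ¹`-radius `≤ D` about `y`, `(D + 1)α ≤ ½` ⊢ the (3.35)-clause on `□` at scale
`Lʲη`, constant `C·L^{2j}`, `C > 4(D + 1)α`: the clamped extension `π^*V` (`B7Prop1Local.clampCfg`; each of its plaquettes is `1` or a plaquette of `V` inside `□`) meets the
GLOBAL hypothesis of the axial-gauge lemma, and §1 carries the clause back to `V`. [cite: Balaban1985RegularSpaces, p.98, (1.7) p.77; Balaban1985BackgroundPropagators, (3.35) p.396] -/
theorem reg335Cube_lowIndex_local {V : B7Prop1Explicit.Site d → Fin d → 𝔸ˣ} (hV : ∀ x κ, V x κ ∈ U1 𝔸) {η : ℝ} (hη : 0 < η) {L : ℕ} (hL : 1 ≤ L) (j : ℕ)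
    {α D : ℝ} (hα : 0 ≤ α) (hD : 0 ≤ D) (hsmall : (D + 1) * α ≤ 1 / 2) {c₀ : B7Prop1Explicit.Site d} {N : ℕ} (hN : 1 ≤ N)
    (h44 : ∀ (x : B7Prop1Explicit.Site d) (κ μ : Fin d), κ ≠ μ → x ∈ boxZd c₀ N → x + e κ + e μ ∈ boxZd c₀ N →
      ‖((hol V x (plaqWord κ μ) : 𝔸ˣ) : 𝔸) - 1‖ ≤ α)
    {y : B7Prop1Explicit.Site d} (hQ : ∀ z ∈ boxZd c₀ N, (l1 (z - y) : ℝ) ≤ D) {C : ℝ} (hC : 4 * (D + 1) * α < C) :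
    Reg335Cube (shiftT d) (byDir V) η (boxZd c₀ N) (scaleLen (L : ℝ) η j) (C * ((L : ℝ) ^ j) ^ 2) := by
  -- the box as `[c₀, hi]`
  set hi : B7Prop1Explicit.Site d := fun μ => c₀ μ + ((N : ℤ) - 1) with hhi
  have hlohi : ∀ μ, c₀ μ ≤ hi μ := fun μ => by simp only [hhi]; omega
  have hbox : ∀ x, x ∈ boxZd c₀ N ↔ InBox c₀ hi x := fun x => by
    simp only [boxZd, Set.mem_setOf_eq, InBox, hhi]
    exact ⟨fun h μ => ⟨(h μ).1, by have := (h μ).2; omega⟩, fun h μ => ⟨(h μ).1, by have := (h μ).2; omega⟩⟩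
  -- the clamped extension and its global plaquette radius
  set V' := clampCfg c₀ hi V with hV'
  have hV'1 : ∀ x κ, V' x κ ∈ U1 𝔸 := fun x κ => clampCfg_mem hV x κ
  have h44' : ∀ (x : B7Prop1Explicit.Site d) (κ μ : Fin d), κ ≠ μ → ‖((hol V' x (plaqWord κ μ) : 𝔸ˣ) : 𝔸) - 1‖ ≤ α := fun x κ μ hκμ =>
    norm_hol_plaqWord_clampCfg_le hlohi V hκμ hα (fun x' hx' => h44 x' κ μ hκμ ((hbox _).2 hx'.1) ((hbox _).2 hx'.2)) x
  have h1 := reg335Cube_lowIndex_of_plaq hV'1 hη hL j hα hD hsmall h44' hQ hC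
  -- back to `V`: the two configurations agree on the bonds of the box
  refine reg335Cube_of_eqOn_box (fun z hz κ hzκ => ?_) h1
  exact (clampCfg_agree V z κ ((hbox z).1 hz) ((hbox _).1 hzκ)).symm

end LowIndex

/-! ## §3 (3.35) for `U₀ ∈ 𝔄_m` by Proposition 6, at the frame of record, at every member with (1.3)–(1.4) — `Ω₀` arbitrary -/

section AtFrame

variable {𝔸 : Type} [CStarAlgebra 𝔸] [Nontrivial 𝔸]

/-- ★★ **[B8] PROPOSITION 6's PRINTED APPLICATION AT EVERY (1.3)–(1.4) MEMBER, `Ω₀` ARBITRARY** — p. 99 «hence … we have proved the regularity condition (3.35).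
This implies that we can drop out this condition from the assumption (1.33)», at the frame of record: for `d ≥ 2`, `L ≥ 2`, a big block `ρ₀ ≥ 1`, an exponent `s` with
`4ρ₀L ≤ L^s`, `B₁ ≥ 0`, `c₁ > 0` and `B8.Prop6Printed d L B₁ c₁ (zdCubP 𝔸 L ρ₀ ∘ f)` for every index map `f`: at every `i : ZdIdx d L` with `DomainSeq L i.Ω`, every
`M ≥ 11d + 1`, every `m`, the binder `Prop6At (bgZd 𝔸 L) L memZd (ιCfgZd 𝔸 L) c35 c₆ 1 M i m` holds with `c35 := (7dL²B₁(20L^s + 2ρ₀) + 84dL^s + 1)·L^{2s}`,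
`c₆ := min (1∕(42dL^s)) (c₁∕(7dL²(20L^s + 2ρ₀)))`.  Index `j ≤ s`: §2 (level-0 clause of `InAk` on `□ ⊆ Ω₀`); `j ≥ s + 1`: `exists_printCube_over_classCube_of_sep` +
Proposition 6 at the lawful datum `⟨i.η, m, i.Ω, Λs ≡ level-0 sites of Ω₀, Λb ≡ ∅⟩` + `reg335Cube_of_gaugedBoundB8` + rescaling by `L^{2s}`.
[cite: Balaban1985RegularSpaces, Prop. 6 (1.135)–(1.138) p.99, p.98, (1.33) p.82, (1.3)–(1.4) p.77, (1.7) p.77; Balaban1985BackgroundPropagators, (3.35) p.396] -/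
theorem prop6At_bgZd_of_prop6Printed (hd2 : 2 ≤ d) {L : ℕ} (hL : 2 ≤ L) {ρ₀ : ℕ} (hρ₀ : 1 ≤ ρ₀) {s : ℕ} (hs : 4 * ρ₀ * L ≤ L ^ s)
    {B₁ c₁ : ℝ} (hB₁ : 0 ≤ B₁) (hc₁ : 0 < c₁)
    (hP6 : ∀ {ι : Type} (f : ι → ZdIdx d L), B8.Prop6Printed d (L : ℝ) B₁ c₁ (fun j => zdCubP 𝔸 L ρ₀ (f j)))
    {M : ℝ} (hM : (11 * d + 1 : ℝ) ≤ M) (i : ZdIdx d L) (hDS : DomainSeq L i.Ω) (m : ℕ) :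
    Prop6At (bgZd 𝔸 L) L memZd (ιCfgZd 𝔸 L)
      ((7 * d * (L : ℝ) ^ 2 * B₁ * (20 * (L : ℝ) ^ s + 2 * ρ₀) + 84 * d * (L : ℝ) ^ s + 1) * ((L : ℝ) ^ s) ^ 2)
      (min (1 / (42 * d * (L : ℝ) ^ s)) (c₁ / (7 * d * (L : ℝ) ^ 2 * (20 * (L : ℝ) ^ s + 2 * ρ₀)))) 1 M i m := by
  intro α₀ U₀ hU₀ hα₀ hMα hIn
  rw [reg335_bgZd_iff]
  have hd1 : 1 ≤ d := le_trans one_le_two hd2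
  have hL1 : 1 ≤ L := le_trans one_le_two hL
  have hdR : (1 : ℝ) ≤ d := by exact_mod_cast hd1
  have hLR : (2 : ℝ) ≤ L := by exact_mod_cast hL
  have hρR : (1 : ℝ) ≤ ρ₀ := by exact_mod_cast hρ₀
  obtain ⟨hd0, hL0, hρ0⟩ : (0 : ℝ) < d ∧ (0 : ℝ) < L ∧ (0 : ℝ) < ρ₀ := ⟨by linarith, by linarith, by linarith⟩
  have hLs1 : (1 : ℝ) ≤ (L : ℝ) ^ s := one_le_pow₀ (by linarith)
  have hη : 0 < i.η := i.hη
  obtain ⟨hM1, hM0⟩ : (1 : ℝ) ≤ M ∧ 0 ≤ M := ⟨le_trans (by linarith) hM, le_trans (by linarith) hM⟩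
  have hMα' : M * α₀ ≤ 1 / (42 * d * (L : ℝ) ^ s) := hMα.trans (min_le_left _ _)
  have hMα'' : M * α₀ ≤ c₁ / (7 * d * (L : ℝ) ^ 2 * (20 * (L : ℝ) ^ s + 2 * ρ₀)) := hMα.trans (min_le_right _ _)
  have hceil : (⌈M⌉₊ : ℝ) ≤ 2 * M := by have := Nat.ceil_lt_add_one hM0; linarith
  have hU1 : ∀ x κ, U₀ x κ ∈ U1 𝔸 := fun x κ => unitaryUnits_le_U1 (hU₀ x κ)
  have hanti : Antitone i.Ω := antitone_nat_of_succ_le i.hΩ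
  set C : ℝ := (7 * d * (L : ℝ) ^ 2 * B₁ * (20 * (L : ℝ) ^ s + 2 * ρ₀) + 84 * d * (L : ℝ) ^ s + 1) * ((L : ℝ) ^ s) ^ 2 * (memZd M i m).M * (1 * α₀)
    with hC
  clear_value C
  have hCM : (memZd M i m).M = M := rfl
  have hCeq : C = (84 * d * (L : ℝ) ^ s + 1) * M * α₀ * ((L : ℝ) ^ s) ^ 2
      + 7 * d * (L : ℝ) ^ 2 * B₁ * (20 * (L : ℝ) ^ s + 2 * ρ₀) * ((L : ℝ) ^ s) ^ 2 * M * α₀ := by rw [hC, hCM]; ring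
  have hCpart : 0 ≤ 7 * d * (L : ℝ) ^ 2 * B₁ * (20 * (L : ℝ) ^ s + 2 * ρ₀) * ((L : ℝ) ^ s) ^ 2 * M * α₀ := by positivity
  have hCpart' : 0 ≤ 84 * d * (L : ℝ) ^ s * M * α₀ * ((L : ℝ) ^ s) ^ 2 := by positivity
  intro q hq
  obtain ⟨hjm, hcube, hsub, -, ⟨z₀, hz₀, -⟩⟩ := hq
  change q.2 ≤ m at hjm
  change IsCube396Zd M L q.2 q.1 at hcube
  have hsubΩ : q.1 ⊆ i.Ω q.2 := fun z hz => by
    have h := hsub hz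
    rw [B9SupplySockB9P3ZdFrame.omTrunc_of_le _ hjm] at h
    exact h
  have hsubΩ0 : q.1 ⊆ i.Ω 0 := hsubΩ.trans (hanti (Nat.zero_le _))
  have hξ : 0 < scaleLen (L : ℝ) i.η q.2 := scaleLen_pos hL0 hη q.2
  rcases Nat.lt_or_ge s q.2 with hsj | hjs
  swap
  · -- LOW INDEX `j ≤ s`: the axial gauge at scale η on the cube itself (plaquettes inside `□ ⊆ Ω₀`), re-read at scale `Lʲη`
    obtain ⟨c₀, n, hn1, hn10, -, hQ⟩ := hcube
    have hcond := (hIn 0 (Nat.zero_le m)).1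
    have hNpos : 1 ≤ n * bigSideZd M L q.2 := by
      have h := (show z₀ ∈ boxZd c₀ (n * bigSideZd M L q.2) by rw [← hQ]; exact hz₀) ⟨0, by omega⟩
      omega
    have h44 : ∀ (x : B7Prop1Explicit.Site d) (κ μ : Fin d), κ ≠ μ → x ∈ boxZd c₀ (n * bigSideZd M L q.2) →
        x + e κ + e μ ∈ boxZd c₀ (n * bigSideZd M L q.2) → ‖((hol U₀ x (plaqWord κ μ) : 𝔸ˣ) : 𝔸) - 1‖ ≤ α₀ := fun x κ μ hκμ hx _ => by
      have hxΩ : x ∈ i.Ω 0 := hsubΩ0 (by rw [hQ]; exact hx)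
      have h := hcond x κ μ hκμ (Or.inl hxΩ)
      simp only [pow_zero, inv_one, one_pow, mul_one] at h
      exact h.le
    have hLj : ((L : ℕ) : ℝ) ^ q.2 ≤ (L : ℝ) ^ s := pow_le_pow_right₀ (by linarith) hjs
    have hrad : ∀ z ∈ boxZd c₀ (n * bigSideZd M L q.2), (l1 (z - c₀) : ℝ) ≤ 20 * d * M * (L : ℝ) ^ s := fun z hz => by
      have h1 := l1_le_of_mem_boxZd hz
      have h2 : (l1 (z - c₀) : ℝ) ≤ d * (n * (⌈M⌉₊ * (L : ℝ) ^ q.2)) := by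
        have : ((d * (n * bigSideZd M L q.2) : ℕ) : ℝ) = d * (n * (⌈M⌉₊ * (L : ℝ) ^ q.2)) := by push_cast [bigSideZd]; ring
        rw [← this]; exact_mod_cast h1
      have hn10R : (n : ℝ) ≤ 10 := by exact_mod_cast hn10
      have h3 : (n : ℝ) * (⌈M⌉₊ * (L : ℝ) ^ q.2) ≤ 10 * (2 * M * (L : ℝ) ^ s) :=
        mul_le_mul hn10R (mul_le_mul hceil hLj (by positivity) (by positivity)) (by positivity) (by norm_num)
      have h4 : (d : ℝ) * (n * (⌈M⌉₊ * (L : ℝ) ^ q.2)) ≤ d * (10 * (2 * M * (L : ℝ) ^ s)) := mul_le_mul_of_nonneg_left h3 (by positivity)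
      linarith
    have hdM : (1 : ℝ) ≤ d * M * (L : ℝ) ^ s := one_le_mul_of_one_le_of_one_le (one_le_mul_of_one_le_of_one_le hdR hM1) hLs1
    have hdMα : α₀ ≤ d * M * (L : ℝ) ^ s * α₀ := by nlinarith
    have hsmall : (20 * d * M * (L : ℝ) ^ s + 1) * α₀ ≤ 1 / 2 := by
      have h1 : (20 * d * M * (L : ℝ) ^ s + 1) * α₀ ≤ 21 * d * (L : ℝ) ^ s * (M * α₀) := by linarith
      have h2 : 21 * d * (L : ℝ) ^ s * (M * α₀) ≤ 21 * d * (L : ℝ) ^ s * (1 / (42 * d * (L : ℝ) ^ s)) :=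
        mul_le_mul_of_nonneg_left hMα' (by positivity)
      have h3 : 21 * (d : ℝ) * (L : ℝ) ^ s * (1 / (42 * d * (L : ℝ) ^ s)) = 1 / 2 := by field_simp; ring
      linarith
    have hC₀ : 4 * (20 * d * M * (L : ℝ) ^ s + 1) * α₀ < (84 * d * (L : ℝ) ^ s + 1) * M * α₀ := by
      have := mul_pos (lt_of_lt_of_le one_pos hM1) hα₀
      linarith
    have h1 := reg335Cube_lowIndex_local hU1 hη hL1 q.2 hα₀.le (by positivity) hsmall hNpos h44 hrad hC₀
    rw [hQ]
    refine reg335Cube_mono (shiftT d) (byDir U₀) hξ ?_ h1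
    have hLj2 : (((L : ℕ) : ℝ) ^ q.2) ^ 2 ≤ ((L : ℝ) ^ s) ^ 2 := pow_le_pow_left₀ (by positivity) hLj 2
    have h2 : (84 * d * (L : ℝ) ^ s + 1) * M * α₀ * (((L : ℕ) : ℝ) ^ q.2) ^ 2 ≤ (84 * d * (L : ℝ) ^ s + 1) * M * α₀ * ((L : ℝ) ^ s) ^ 2 :=
      mul_le_mul_of_nonneg_left hLj2 (by positivity)
    linarith
  · -- INDEX `j ≥ s + 1`: Proposition 6 at a print cube of index `j − s`
    have hm1 : 1 ≤ m := by omega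
    obtain ⟨c, hcP, hck, hQc, hcM⟩ :=
      exists_printCube_over_classCube_of_sep hd1 hL hρ₀ hs hDS hM (j := q.2) (m := m) hsj hjm hcube hsubΩ
    -- the auxiliary lawful datum with `(k, η, Ω) = (m, i.η, i.Ω)`, towers = the level-0 sites of `Ω₀`
    let i' : ZdIdx d L :=
      { η := i.η, hη := i.hη, k := m, hk := hm1, Ω := i.Ω, hΩ := i.hΩ,
        Λs := fun _ j => {y | j = 0 ∧ y ∈ i.Ω 0}, Λb := fun _ _ => ∅,
        hbox := fun _ _ _ _ c hc => ((Set.mem_empty_iff_false c).1 hc).elim,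
        hclass := fun _ _ _ _ c hc => ((Set.mem_empty_iff_false c).1 hc).elim,
        htower := fun j _ y hy x hx => by
          obtain ⟨hj0, hy0⟩ := hy
          subst hj0
          have hxy : x = y := funext fun μ => by
            have h := hx μ
            simp only [tlo_zero, thi_zero] at h
            exact le_antisymm h.2 h.1
          rw [hxy]; exact hy0,
        hpart := fun x hx => ⟨0, Nat.zero_le _, x, ⟨rfl, hx⟩, fun μ => by simp only [tlo_zero, thi_zero]; exact ⟨le_rfl, le_rfl⟩⟩ }
    have hP := (prop6Printed_zdCubP_iff (𝔸 := 𝔸) (fun _ : Unit => i') ρ₀ B₁ c₁).1 (hP6 _) () α₀ hα₀ ⟨U₀, hU₀⟩ hIn c hcP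
    have hcMR : (c.M : ℝ) ≤ (20 * (L : ℝ) ^ s + 2 * ρ₀) * M := by
      have h2 : 10 * ⌈M⌉₊ * (L : ℝ) ^ s + 2 * ρ₀ ≤ (20 * (L : ℝ) ^ s + 2 * ρ₀) * M := by
        have e1 := mul_le_mul_of_nonneg_right hceil (le_trans zero_le_one hLs1)
        have e2 := mul_le_mul_of_nonneg_left hM1 hρ0.le
        linarith
      exact hcM.trans h2
    have hpos : 0 < 7 * d * (L : ℝ) ^ 2 * (20 * (L : ℝ) ^ s + 2 * ρ₀) := by positivity
    have hthr : 7 * d * (L : ℝ) ^ 2 * c.M * α₀ ≤ c₁ := by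
      have h1 : 7 * d * (L : ℝ) ^ 2 * c.M * α₀ ≤ 7 * d * (L : ℝ) ^ 2 * ((20 * (L : ℝ) ^ s + 2 * ρ₀) * M) * α₀ := by
        apply mul_le_mul_of_nonneg_right _ hα₀.le
        exact mul_le_mul_of_nonneg_left hcMR (by positivity)
      have h2 : 7 * d * (L : ℝ) ^ 2 * ((20 * (L : ℝ) ^ s + 2 * ρ₀) * M) * α₀ = 7 * d * (L : ℝ) ^ 2 * (20 * (L : ℝ) ^ s + 2 * ρ₀) * (M * α₀) := by ring
      have h3 : 7 * d * (L : ℝ) ^ 2 * (20 * (L : ℝ) ^ s + 2 * ρ₀) * (M * α₀) ≤ c₁ :=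
        calc 7 * d * (L : ℝ) ^ 2 * (20 * (L : ℝ) ^ s + 2 * ρ₀) * (M * α₀)
            ≤ 7 * d * (L : ℝ) ^ 2 * (20 * (L : ℝ) ^ s + 2 * ρ₀) * (c₁ / (7 * d * (L : ℝ) ^ 2 * (20 * (L : ℝ) ^ s + 2 * ρ₀))) :=
              mul_le_mul_of_nonneg_left hMα'' hpos.le
          _ = c₁ := by field_simp
      linarith
    have hG : GaugedBoundB8 L i.η U₀ c (7 * d * (L : ℝ) ^ 2 * B₁ * c.M * α₀) := hP hthr
    have hrC : 7 * d * (L : ℝ) ^ 2 * B₁ * c.M * α₀ < 7 * d * (L : ℝ) ^ 2 * B₁ * (20 * (L : ℝ) ^ s + 2 * ρ₀) * M * α₀ + M * α₀ := by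
      have h1 : 7 * d * (L : ℝ) ^ 2 * B₁ * c.M * α₀ ≤ 7 * d * (L : ℝ) ^ 2 * B₁ * ((20 * (L : ℝ) ^ s + 2 * ρ₀) * M) * α₀ := by
        apply mul_le_mul_of_nonneg_right _ hα₀.le
        exact mul_le_mul_of_nonneg_left hcMR (by positivity)
      have h2 : 0 < M * α₀ := mul_pos (lt_of_lt_of_le one_pos hM1) hα₀
      linarith
    have hres := reg335Cube_of_gaugedBoundB8 hd2 hL hη c hrC hG hQc
    have hC'0 : 0 ≤ 7 * d * (L : ℝ) ^ 2 * B₁ * (20 * (L : ℝ) ^ s + 2 * ρ₀) * M * α₀ + M * α₀ := by positivity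
    have hres2 := reg335Cube_rescale (shiftT d) (byDir U₀) (Λ := (L : ℝ) ^ s) (scaleLen_pos hL0 hη c.k) hLs1 hC'0 hres
    have hsc : (L : ℝ) ^ s * scaleLen (L : ℝ) i.η c.k = scaleLen (L : ℝ) i.η q.2 := by
      rw [hck, scaleLen, scaleLen, ← mul_assoc, ← pow_add, Nat.add_sub_cancel' hsj.le]
    rw [hsc] at hres2
    refine reg335Cube_mono (shiftT d) (byDir U₀) hξ ?_ hres2
    have h3 : (7 * d * (L : ℝ) ^ 2 * B₁ * (20 * (L : ℝ) ^ s + 2 * ρ₀) * M * α₀ + M * α₀) * ((L : ℝ) ^ s) ^ 2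
        = 7 * d * (L : ℝ) ^ 2 * B₁ * (20 * (L : ℝ) ^ s + 2 * ρ₀) * ((L : ℝ) ^ s) ^ 2 * M * α₀ + M * α₀ * ((L : ℝ) ^ s) ^ 2 := by ring
    have h4 : M * α₀ * ((L : ℝ) ^ s) ^ 2 ≤ (84 * d * (L : ℝ) ^ s + 1) * M * α₀ * ((L : ℝ) ^ s) ^ 2 := by
      have : (0 : ℝ) ≤ 84 * d * (L : ℝ) ^ s := by positivity
      have hp : 0 ≤ M * α₀ * ((L : ℝ) ^ s) ^ 2 := by positivity
      nlinarith
    linarith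

/-- **`∃`-PACKAGING** of `prop6At_bgZd_of_prop6Printed` (any admissible `s`): positive `c35, c₆`, `K₆ = 1`, `M₃ = 11d + 1`, over every (1.3)–(1.4) member.
[cite: Balaban1985RegularSpaces, Prop. 6 p.99, (1.33) p.82, (1.3)–(1.4) p.77; Balaban1985BackgroundPropagators, (3.35) p.396] -/
theorem exists_prop6At_bgZd_of_prop6Printed (hd2 : 2 ≤ d) {L : ℕ} (hL : 2 ≤ L) {ρ₀ : ℕ} (hρ₀ : 1 ≤ ρ₀) {s : ℕ} (hs : 4 * ρ₀ * L ≤ L ^ s)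
    {B₁ c₁ : ℝ} (hB₁ : 0 ≤ B₁) (hc₁ : 0 < c₁)
    (hP6 : ∀ {ι : Type} (f : ι → ZdIdx d L), B8.Prop6Printed d (L : ℝ) B₁ c₁ (fun j => zdCubP 𝔸 L ρ₀ (f j))) :
    ∃ c35 c₆ K₆ M₃ : ℝ, 0 < c35 ∧ 0 < c₆ ∧ 0 < K₆ ∧ 0 < M₃ ∧
      ∀ (M : ℝ) (i : ZdIdx d L) (m : ℕ), DomainSeq L i.Ω → M₃ ≤ M →
        Prop6At (bgZd 𝔸 L) L memZd (ιCfgZd 𝔸 L) c35 c₆ K₆ M i m := by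
  have hd0 : (0 : ℝ) < d := by exact_mod_cast (lt_of_lt_of_le zero_lt_two hd2)
  have hL0 : (0 : ℝ) < L := by exact_mod_cast (lt_of_lt_of_le zero_lt_two hL)
  have hρ0 : (0 : ℝ) < ρ₀ := by exact_mod_cast (lt_of_lt_of_le zero_lt_one hρ₀)
  refine ⟨(7 * d * (L : ℝ) ^ 2 * B₁ * (20 * (L : ℝ) ^ s + 2 * ρ₀) + 84 * d * (L : ℝ) ^ s + 1) * ((L : ℝ) ^ s) ^ 2,
    min (1 / (42 * d * (L : ℝ) ^ s)) (c₁ / (7 * d * (L : ℝ) ^ 2 * (20 * (L : ℝ) ^ s + 2 * ρ₀))), 1, 11 * d + 1,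
    by positivity, lt_min (by positivity) (by positivity), one_pos, by positivity, fun M i m hDS hM => ?_⟩
  exact prop6At_bgZd_of_prop6Printed hd2 hL hρ₀ hs hB₁ hc₁ hP6 hM i hDS m

end AtFrame

/-! ## §4 The unconditional form: `d ≥ 2`, `L ≥ 5` odd; the binder shape; the cube members -/

section Holds

variable {𝔸 : Type} [CStarAlgebra 𝔸] [Nontrivial 𝔸]

/-- ★★★ **[B8] PROPOSITION 6's PRINTED APPLICATION AT EVERY (1.3)–(1.4) MEMBER, UNCONDITIONAL** (`d ≥ 2`, `L ≥ 5` odd, any nontrivial C⋆-algebra `𝔸`, ANY `Ω₀`):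
`∃ c35 c₆ K₆ M₃ > 0` such that for every `i : ZdIdx d L` with `DomainSeq L i.Ω`, every `M ≥ M₃` and every `m`, dag-n06-b's junction binder
`Prop6At (bgZd 𝔸 L) L memZd (ιCfgZd 𝔸 L) c35 c₆ K₆ M i m` — «U₀ ∈ 𝔄_m({Ω_j}, α₀), Mα₀ ≤ c₆ ⇒ U₀ satisfies (3.35) of [4] on the p. 396 cube class, O(1)Mα₀ =
c35·M·K₆α₀» — HOLDS: §3 with `s := 4ρ₀L` ∘ `B8Prop6PrintedZdCubPGamma.prop6Printed_zdCubP_γ_holds`.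
[cite: Balaban1985RegularSpaces, Prop. 6 (1.135)–(1.138) p.99, (1.33) p.82, (1.3)–(1.4) p.77, p.98; Balaban1985BackgroundPropagators, (3.35) p.396] -/
theorem prop6At_bgZd_domainSeq_holds (hd2 : 2 ≤ d) {L : ℕ} (hL5 : 5 ≤ L) (hodd : Odd L) :
    ∃ c35 c₆ K₆ M₃ : ℝ, 0 < c35 ∧ 0 < c₆ ∧ 0 < K₆ ∧ 0 < M₃ ∧
      ∀ (M : ℝ) (i : ZdIdx d L) (m : ℕ), DomainSeq L i.Ω → M₃ ≤ M →
        Prop6At (bgZd 𝔸 L) L memZd (ιCfgZd 𝔸 L) c35 c₆ K₆ M i m := by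
  obtain ⟨ρ₀, B₀, c₁, hρ₀, hB₀, hc₁, H⟩ := prop6Printed_zdCubP_γ_holds (𝔸 := 𝔸) hd2 hL5 hodd
  have hL : 2 ≤ L := le_trans (by norm_num) hL5
  have hB₁ : 0 ≤ 5 * (d : ℝ) * L * B₀ := by
    have : (0 : ℝ) ≤ B₀ := le_trans zero_le_one hB₀
    positivity
  have hs : 4 * ρ₀ * L ≤ L ^ (4 * ρ₀ * L) := (Nat.lt_pow_self (by omega : 1 < L)).le
  exact exists_prop6At_bgZd_of_prop6Printed hd2 hL hρ₀ hs hB₁ hc₁ (fun f => H f)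

/-- ★★★ **THE BINDER SHAPE OVER A LAW CLASS** (any side law `P` on the datum — NODE 00's `IdxB8LawsB θ.L`, a knit's cube-member predicate —, the domain laws as
`DomainSeq L i.Ω`; no `Ω₀ = univ` clause): `d ≥ 2`, `L ≥ 5` odd ⊢ `∃ c35 c₆ K₆ M₃ > 0, ∀ M i m, P i → DomainSeq L i.Ω → M₃ ≤ M → Prop6At (bgZd 𝔸 L) … c35 c₆ K₆ M i m`.
[cite: Balaban1985RegularSpaces, Prop. 6 p.99, (1.33) p.82, (1.3)–(1.4) p.77; Balaban1985BackgroundPropagators, (3.35) p.396, Thm 3.3 p.399] -/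
theorem prop6At_binder_domainSeq_holds (hd2 : 2 ≤ d) {L : ℕ} (hL5 : 5 ≤ L) (hodd : Odd L) (P : ZdIdx d L → Prop) :
    ∃ c35 c₆ K₆ M₃ : ℝ, 0 < c35 ∧ 0 < c₆ ∧ 0 < K₆ ∧ 0 < M₃ ∧
      ∀ (M : ℝ) (i : ZdIdx d L) (m : ℕ), P i → DomainSeq L i.Ω → M₃ ≤ M →
        Prop6At (bgZd 𝔸 L) L memZd (ιCfgZd 𝔸 L) c35 c₆ K₆ M i m := by
  obtain ⟨c35, c₆, K₆, M₃, h35, h₆, hK, hM₃, H⟩ := prop6At_bgZd_domainSeq_holds (𝔸 := 𝔸) hd2 hL5 hodd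
  exact ⟨c35, c₆, K₆, M₃, h35, h₆, hK, hM₃, fun M i m _ hDS hM => H M i m hDS hM⟩

/-- ★ **THE CUBE MEMBERS OF THE TREE** (print's family (1.131) `{□_j}` — `B8Eq131CubesAdmissible.cubeFam top L a M₀ ρ k`, `top = true`: `Ω₀ = T`, `top = false`: `Ω₀ = □₀`;
`L ≤ ρ`): `d ≥ 2`, `L ≥ 5` odd ⊢ `∃ c35 c₆ K₆ M₃ > 0` with `Prop6At (bgZd 𝔸 L) L memZd (ιCfgZd 𝔸 L) c35 c₆ K₆ M i m` at every datum `i` whose domain sequence is such a family,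
every `M ≥ M₃`, every `m` — by `cubeFam_domainSeq` (the members at which dag-n06-b's genuine-record supplier displays the binder). [cite: Balaban1985RegularSpaces, (1.131) p.99, Prop. 6 p.99; Balaban1985BackgroundPropagators, (3.35) p.396] -/
theorem prop6At_bgZd_cubeFam_holds (hd2 : 2 ≤ d) {L : ℕ} (hL5 : 5 ≤ L) (hodd : Odd L) :
    ∃ c35 c₆ K₆ M₃ : ℝ, 0 < c35 ∧ 0 < c₆ ∧ 0 < K₆ ∧ 0 < M₃ ∧
      ∀ (M : ℝ) (i : ZdIdx d L) (m : ℕ) (top : Bool) (a : B7Prop1Explicit.Site d) (M₀ ρ k : ℕ),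
        L ≤ ρ → i.Ω = cubeFam top L a M₀ ρ k → M₃ ≤ M →
          Prop6At (bgZd 𝔸 L) L memZd (ιCfgZd 𝔸 L) c35 c₆ K₆ M i m := by
  obtain ⟨c35, c₆, K₆, M₃, h35, h₆, hK, hM₃, H⟩ := prop6At_bgZd_domainSeq_holds (𝔸 := 𝔸) hd2 hL5 hodd
  have hL1 : 1 ≤ L := le_trans (by norm_num) hL5
  refine ⟨c35, c₆, K₆, M₃, h35, h₆, hK, hM₃, fun M i m top a M₀ ρ k hρ hΩ hM => H M i m ?_ hM⟩
  rw [hΩ]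
  exact cubeFam_domainSeq top hL1 a M₀ hρ k

end Holds

end Literature.MathematicalPhysics.QuantumFieldTheory.Balaban1983to89.B8Prop6Reg335ZdDomainSeq

end
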